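import Literature.NumberTheory.LFunctions.ElementaryDeuringHeilbronnPhenomenon
import Mathlib.NumberTheory.LegendreSymbol.QuadraticChar.Basic
import HarnessLib

/-!
# The Deuring phenomenon by elementary methods (Pintz 1976, part III): under
# `h(−D) ≤ log D/(2 log log D)` the Siegel zero is the ONLY zero near `1` and
# `δ = 6h(−D)(1 + O(1/log D))/(π∏_{p∣D}(1+1/p)√D)`; under `h(−D) ≤ (log D)^{3/4}` neither `L(s,χ)`
# nor `ζ(s)` vanishes in `H(ε,D)` and `L(s) = ζ(2s)ζ(s)⁻¹∏_{p∣D}(1+p^{−s})[1+O(e^{−⅛ log^{1/4}D})]`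
# — AS PRINTED

Topic `Literature/NumberTheory/LFunctions` (namespace `Literature.NumberTheory.LFunctions`; the
paper's objects in the sub-namespace `Pintz1976Deuring`). STATEMENT LAYER (D-0014) typed for the cell
`parity-realchar` (SIEGEL INSTRUMENT, conditionals column topic I.1 «class numbers»/the Deuring
direction; companion of `pintz1976_theorem2` (part II: the same `δ ∼ 6h/(π∏√D)` with `o(1)`, here with
the rate `O(1/log D)` plus uniqueness and simplicity of the zero) and of `bellottiPuglisi2023_theorem1`
(the 2023 refinement of Theorem 2's "illusory `L`-function", whose `mainTerm` is reused)) and cc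
`landau-siegel` (§C). Source: J. Pintz, *Elementary methods in the theory of L-functions, III. The
Deuring-phenomenon*, Acta Arith. **31** (1976) 295–306 [Pintz1976ElementaryIII]; the journal scan
(`matwbn.icm.edu.pl/ksiazki/aa/aa31/aa31311.pdf`, corpus key `paper:url-c019e197b0f7`; re-fetched
2026-08-29 as `paper:url-dc41f4bea12a`, image-only, pp. 296–300 rendered again for the Lemma 4 repair)
was rendered page by page and READ (pp. 295–306), 2026-08-27.

## What the source prints (verbatim)

p. 296: "In our theorems all the constants implied in the `o` and `O` symbols will be effective. In
our theorems `h(−D)` will denote the class number of the imaginary quadratic field belonging to the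
fundamental discriminant `−D < 0`; `L(s) = L(s, χ)` the `L`-function belonging to the real primitive
character `χ(n) = (−D/n)`. We shall assume that `D > D₁`, where `D₁` is an absolute effective
constant. Then we state
**THEOREM 1.** If the inequality (1.3) `h(−D) ≤ log D/(2 log log D)` holds and `H` denotes the domain
(1.4) `H = {s ; |1 − s| ≤ 1/log⁴D}`, then `L(s)` has a single simple real zero `1 − δ` in `H`, for
which one has (1.5) `δ = (L(1)/(∏_{p∣D}(1 + 1/p) π²/6))(1 + O(1/log D)) =
6h(−D)(1 + O(1/log D))/(∏_{p∣D}(1 + 1/p) π√D)`, and for `s ∈ H` the relation (1.6)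
`L(s) − L(1) = L(s) − πh(−D)/√D = (s − 1)∏_{p∣D}(1 + 1/p)(π²/6)(1 + O(1/log D))` holds.
**THEOREM 2.** We define a domain `H(ε, D)`, depending on `ε`, for which `0 < ε < 1/8`, and on `D`,
where `D > D₁(ε)` (`D₁(ε)` is an effective constant depending on `ε`). Let (1.7)
`H(ε, D) = {s ; s = 1 − τ + it, |1 − s| ≥ 1/log⁴D, 0 ≤ τ ≤ ¼ − ε, |s| ≤ D^{(¼ − ε/2)(1/ϱ) − ¾}`
`where ϱ = max(τ, D^{−ε/4})}`. If the inequality (1.8) `h(−D) ≤ (log D)^{3/4}` holds, then neither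
`L(s)` nor `ζ(s)` has a zero in `H(ε, D)`, and for `s ∈ H(ε, D)` one has (1.9)
`L(s) = (ζ(2s)/ζ(s)) ∏_{p∣D}(1 + 1/p^s)[1 + O(exp(−⅛ log^{1/4}D))]`."
p. 297: "**LEMMA 1.** If (1.3) is valid, then the relation (2.1)
`L'(1) = ∏_{p∣D}(1 + 1/p)(π²/6)(1 + O(1/log D)) > 1` holds." (proof of Theorem 1, p. 298: "from
Lemma 2 and Lemma 3 we know that `L(s)` can have at most one, simple zero in the domain `H`").
p. 298: "**LEMMA 4.** Let `χ` be any real or complex non-principal character modulo `D`,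
`L(s) = L(s, χ)`. Then with the notations (3.1) `g(n) = Σ_{d∣n} χ(d)`, `1 ≠ s = 1 − τ + it`,
`A_s = max(1, 1/|1 − s|)` for `0 ≤ τ ≤ ½` and for an arbitrary real `x ≥ |s|²A_s√D` the relation
(3.2) `Σ_{n≤x} g(n)/n^s = L(s)ζ(s) + L(1)x^{1−s}/(1 − s) + O(x^τ|s| D^{1/4} √A_s log D log x/√x)`
holds." (p. 299: "the constant in `O` symbol is absolute" for the ingredients.)

## How it is typed

* Over imaginary quadratic fields `K` (`−D = d_K`, `h(−D) = h_K`) and the odd primitive quadratic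
  character `χ` mod `D = |d_K|` (= `(−D/·)`), the K-pattern of `pintz1976_theorem2` /
  `bellottiPuglisi2023_theorem1`. "`D > D₁` absolute effective" and the effective `O`-constants are
  rendered `∃ C, ∃ D₁` (resp. `∃ C D₁` after `∀ ε` for Theorem 2).
* Theorem 1: "a single simple real zero `1 − δ` in `H`" = there is `δ` with `|δ| ≤ 1/log⁴D`,
  `L(1 − δ) = 0`, `L'(1 − δ) ≠ 0`, and every zero of `L` in `H` (complex `s` allowed) equals `1 − δ`;
  then `δ > 0` automatically. (1.5) as `|δ/M − 1| ≤ C/log D` for both printed main terms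
  `M = L(1)/(∏(1+1/p)π²/6)` and `M = 6h(−D)/(∏(1+1/p)π√D)`; (1.6) as
  `‖(L(s) − L(1)) − (s − 1)P π²/6‖ ≤ ‖(s − 1)P π²/6‖·C/log D`, `P = ∏_{p∣D}(1 + 1/p)` (the middle
  identity `L(1) = πh(−D)/√D` of (1.6) is Dirichlet's class number formula, `D > 4`, proved in the
  tree — not restated).
* Theorem 2: `H(ε, D)` = `Pintz1976Deuring.region ε D`; main term = `BellottiPuglisi2023.mainTerm`.
* Lemma 4: any non-principal `χ` mod `D` (real or complex, imprimitive allowed), complex-valued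
  `g = 1 ∗ χ`, one absolute `C`. The first rendering `pintz1976Deuring_lemma4` quantified over EVERY
  modulus `D` and is FALSE as typed (`pintz1976Deuring_lemma4_false`: `D = 3`, `s = 1/2`, `x = 9/10`
  resp. `x = 2, 5/2`); it is kept verbatim and flagged, and the REPAIRED named fact
  `pintz1976Deuring_lemma4_largeD` restores the paper's standing assumption "`D > D₁`" (p. 296) as
  `∃ C D₁, ∀ D > D₁` (then `x ≥ |s|²A_s√D ≥ √D/2` and `log x ≥ 1`).

## Contents

defs `Pintz1976Deuring.nearOne` (`H` of (1.4)), `.region` (`H(ε,D)` of (1.7)), `.eulerFactor`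
(`∏_{p∣D}(1+1/p)`); NAMED FACTS `pintz1976Deuring_theorem1`, `pintz1976Deuring_theorem2`,
`pintz1976Deuring_lemma1`, `pintz1976Deuring_lemma4` (MIS-STATED as typed, kept verbatim),
`pintz1976Deuring_lemma4_largeD` (its repaired form); PROVED `Pintz1976Deuring.eulerFactor_pos`,
`pintz1976Deuring_lemma4_false` (`¬ pintz1976Deuring_lemma4`, witness `D = 3`, `χ₃` mod `3`, `s = 1/2`),
`Pintz1976Deuring.riemannZeta_ne_zero_of_theorem2` (Theorem 2's `ζ`-clause isolated: a field with
`h(−D) ≤ (log D)^{3/4}`, `D > D₁(ε)`, makes `ζ` zero-free on `H(ε, D)`).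

Index only: Lemmas 2–3 (p. 297: `L'(s) = L'(1)(1+O(1/log D)) ≠ 0` on `H`, injectivity of `L` on `H`),
Lemmas 5–6 (§4, the technical core), the remark p. 295 ("if `h(−D) ↛ ∞` then `ζ(s)` has no zero in
`σ > ¾`", a weakened Mordell theorem — cf. `bellottiPuglisi2023_corollary1`).

LABEL (cell rule): instrument / statement layer. WHAT THIS IS NOT: no claim that any field with
`h(−D) ≤ log D/(2 log log D)` or `≤ (log D)^{3/4}` exists beyond an effective bound (Siegel /
Goldfeld–Gross–Zagier–Oesterlé); nothing here bears on parity. No instances, no notation, no axioms.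

## References

* [Pintz1976ElementaryIII] J. Pintz, Acta Arith. 31 (1976) 295–306: Theorem 1 and Theorem 2 pp.
  296–297 (1.3)–(1.9); standing assumption "`D > D₁`" p. 296; Lemma 1 p. 297 (2.1); Lemma 4 p. 298
  (3.1)–(3.2), its proof pp. 298–300 (3.3)–(3.9) (re-read from the journal scan 2026-08-29 for the
  repair); proofs §§2–5.
* [Pintz1976ElementaryII] (`pintz1976_theorem2`), [BellottiPuglisi2023] (`mainTerm`, Theorem 1).
-/

noncomputable section

open Complex Finset

namespace Literature.NumberTheory.LFunctions

namespace Pintz1976Deuring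

/-- `H = {s : |1 − s| ≤ 1/log⁴D}` (1.4). [cite: Pintz1976ElementaryIII, Theorem 1 (1.4) p. 296] -/
def nearOne (D : ℕ) : Set ℂ :=
  {s : ℂ | ‖1 - s‖ ≤ 1 / Real.log D ^ 4}

/-- `H(ε, D) = {s = 1 − τ + it : |1 − s| ≥ 1/log⁴D, 0 ≤ τ ≤ ¼ − ε, |s| ≤ D^{(¼ − ε/2)(1/ϱ) − ¾}}`,
`ϱ = max(τ, D^{−ε/4})` (1.7) (with `τ = 1 − Re s`). [cite: Pintz1976ElementaryIII, Theorem 2 (1.7) p. 296] -/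
def region (ε : ℝ) (D : ℕ) : Set ℂ :=
  {s : ℂ | 1 / Real.log D ^ 4 ≤ ‖1 - s‖ ∧ 0 ≤ 1 - s.re ∧ 1 - s.re ≤ 1 / 4 - ε ∧
    ‖s‖ ≤ (D : ℝ) ^ ((1 / 4 - ε / 2) / max (1 - s.re) ((D : ℝ) ^ (-ε / 4)) - 3 / 4)}

/-- `∏_{p ∣ D} (1 + 1/p)`. [cite: Pintz1976ElementaryIII, Theorem 1 (1.5) p. 296] -/
def eulerFactor (D : ℕ) : ℝ := ∏ p ∈ D.primeFactors, (1 + 1 / (p : ℝ))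

/-- `∏_{p ∣ D}(1 + 1/p) > 0`. [cite: Pintz1976ElementaryIII, Theorem 1 (1.5) p. 296] -/
theorem eulerFactor_pos (D : ℕ) : 0 < eulerFactor D :=
  prod_pos fun p _ => by positivity

end Pintz1976Deuring

open Pintz1976Deuring
open BellottiPuglisi2023 (mainTerm)

/-- **Pintz 1976 (III), Theorem 1 (NAMED FACT, as printed, p. 296 (1.3)–(1.6)).** `−D < 0`
fundamental, `D > D₁` (absolute, effective), `χ = (−D/·)`, `h(−D) ≤ log D/(2 log log D)`,
`H = {s : |1−s| ≤ 1/log⁴D}`: "then `L(s)` has a single simple real zero `1 − δ` in `H`, for which one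
has `δ = (L(1)/(∏_{p∣D}(1+1/p)π²/6))(1 + O(1/log D)) = 6h(−D)(1 + O(1/log D))/(∏_{p∣D}(1+1/p)π√D)`,
and for `s ∈ H` the relation `L(s) − L(1) = (s − 1)∏_{p∣D}(1+1/p)(π²/6)(1 + O(1/log D))` holds."
K-pattern, `∃ C D₁`. Unproved here (§2: Lemmas 1–3, from part II).
[cite: Pintz1976ElementaryIII, Theorem 1 p. 296 (1.3)–(1.6)] -/
def pintz1976Deuring_theorem1 : Prop :=
  ∃ C : ℝ, ∃ D₁ : ℕ, ∀ (K : Type) [Field K] [NumberField K] [NeZero (NumberField.discr K).natAbs],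
    Module.finrank ℚ K = 2 → NumberField.discr K < 0 → D₁ < (NumberField.discr K).natAbs →
    (NumberField.classNumber K : ℝ) ≤
        Real.log (NumberField.discr K).natAbs /
          (2 * Real.log (Real.log (NumberField.discr K).natAbs)) →
    ∀ χ : DirichletCharacter ℂ (NumberField.discr K).natAbs,
      χ.IsQuadratic → χ.IsPrimitive → χ.Odd →
      ∃ δ : ℝ, |δ| ≤ 1 / Real.log (NumberField.discr K).natAbs ^ 4 ∧
        χ.LFunction ((1 - δ : ℝ) : ℂ) = 0 ∧ deriv χ.LFunction ((1 - δ : ℝ) : ℂ) ≠ 0 ∧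
        (∀ s : ℂ, s ∈ nearOne (NumberField.discr K).natAbs → χ.LFunction s = 0 →
          s = ((1 - δ : ℝ) : ℂ)) ∧
        |δ / ((χ.LFunction 1).re / (eulerFactor (NumberField.discr K).natAbs * (Real.pi ^ 2 / 6))) -
            1| ≤ C / Real.log (NumberField.discr K).natAbs ∧
        |δ / (6 * (NumberField.classNumber K : ℝ) /
              (eulerFactor (NumberField.discr K).natAbs * Real.pi *
                Real.sqrt (NumberField.discr K).natAbs)) - 1| ≤
          C / Real.log (NumberField.discr K).natAbs ∧
        ∀ s : ℂ, s ∈ nearOne (NumberField.discr K).natAbs →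
          ‖(χ.LFunction s - χ.LFunction 1) -
              (s - 1) * (eulerFactor (NumberField.discr K).natAbs * (Real.pi ^ 2 / 6) : ℝ)‖ ≤
            ‖(s - 1) * (eulerFactor (NumberField.discr K).natAbs * (Real.pi ^ 2 / 6) : ℝ)‖ * C /
              Real.log (NumberField.discr K).natAbs

/-- **Pintz 1976 (III), Theorem 2 (NAMED FACT, as printed, pp. 296–297 (1.7)–(1.9)).** `0 < ε < 1/8`,
`D > D₁(ε)` (effective), `−D` fundamental, `χ = (−D/·)`, `H(ε, D)` as in (1.7): "If the inequality
`h(−D) ≤ (log D)^{3/4}` holds, then neither `L(s)` nor `ζ(s)` has a zero in `H(ε, D)`, and for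
`s ∈ H(ε, D)` one has `L(s) = (ζ(2s)/ζ(s)) ∏_{p∣D}(1 + 1/p^s)[1 + O(exp(−⅛ log^{1/4}D))]`."
K-pattern, `∃ C D₁` after `ε`; main term = `BellottiPuglisi2023.mainTerm`. Unproved here (§§3–5).
[cite: Pintz1976ElementaryIII, Theorem 2 pp. 296–297 (1.7)–(1.9)] -/
def pintz1976Deuring_theorem2 : Prop :=
  ∀ ε : ℝ, 0 < ε → ε < 1 / 8 → ∃ C : ℝ, ∃ D₁ : ℕ, ∀ (K : Type) [Field K] [NumberField K]
    [NeZero (NumberField.discr K).natAbs], Module.finrank ℚ K = 2 → NumberField.discr K < 0 →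
    D₁ < (NumberField.discr K).natAbs →
    (NumberField.classNumber K : ℝ) ≤ Real.log (NumberField.discr K).natAbs ^ (3 / 4 : ℝ) →
    ∀ χ : DirichletCharacter ℂ (NumberField.discr K).natAbs,
      χ.IsQuadratic → χ.IsPrimitive → χ.Odd →
      ∀ s : ℂ, s ∈ Pintz1976Deuring.region ε (NumberField.discr K).natAbs →
        χ.LFunction s ≠ 0 ∧ riemannZeta s ≠ 0 ∧
        ‖χ.LFunction s - mainTerm (NumberField.discr K).natAbs s‖ ≤
          ‖mainTerm (NumberField.discr K).natAbs s‖ * C *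
            Real.exp (-(1 / 8) * Real.log (NumberField.discr K).natAbs ^ (1 / 4 : ℝ))

/-- **Pintz 1976 (III), Lemma 1 (NAMED FACT, as printed, p. 297 (2.1)).** Under (1.3) (`D > D₁`):
"`L'(1) = ∏_{p∣D}(1 + 1/p)(π²/6)(1 + O(1/log D)) > 1`." ("This is Theorem 2 in [6]" — part II —
with the rate.) `L'(1)` real for real `χ`. K-pattern, `∃ C D₁`. Unproved here.
[cite: Pintz1976ElementaryIII, Lemma 1 p. 297 (2.1)] -/
def pintz1976Deuring_lemma1 : Prop :=
  ∃ C : ℝ, ∃ D₁ : ℕ, ∀ (K : Type) [Field K] [NumberField K] [NeZero (NumberField.discr K).natAbs],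
    Module.finrank ℚ K = 2 → NumberField.discr K < 0 → D₁ < (NumberField.discr K).natAbs →
    (NumberField.classNumber K : ℝ) ≤
        Real.log (NumberField.discr K).natAbs /
          (2 * Real.log (Real.log (NumberField.discr K).natAbs)) →
    ∀ χ : DirichletCharacter ℂ (NumberField.discr K).natAbs,
      χ.IsQuadratic → χ.IsPrimitive → χ.Odd →
        |(deriv χ.LFunction 1).re / (eulerFactor (NumberField.discr K).natAbs * (Real.pi ^ 2 / 6)) -
            1| ≤ C / Real.log (NumberField.discr K).natAbs ∧
          1 < (deriv χ.LFunction 1).re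

/-- **Pintz 1976 (III), Lemma 4 (NAMED FACT, as printed, p. 298 (3.1)–(3.2)).** "Let `χ` be any real
or complex non-principal character modulo `D`, `L(s) = L(s, χ)`. Then with the notations
`g(n) = Σ_{d∣n} χ(d)`, `1 ≠ s = 1 − τ + it`, `A_s = max(1, 1/|1 − s|)` for `0 ≤ τ ≤ ½` and for an
arbitrary real `x ≥ |s|²A_s√D` the relation
`Σ_{n≤x} g(n)/n^s = L(s)ζ(s) + L(1)x^{1−s}/(1 − s) + O(x^τ|s| D^{1/4} √A_s log D log x/√x)` holds."
One absolute `C`. Unproved here (pp. 298–300, Pólya–Vinogradov and partial summation).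
**MIS-STATED AS TYPED (kept verbatim, do not use):** this rendering quantifies over EVERY modulus
`D`, dropping the paper's standing assumption "`D > D₁`" (p. 296); for `D = 3` the admissible `x`
go down to `√3/2 < 1`, where `log x ≤ 0`, and the `Prop` is false —
`pintz1976Deuring_lemma4_false` below. The repaired statement is `pintz1976Deuring_lemma4_largeD`.
[cite: Pintz1976ElementaryIII, Lemma 4 p. 298 (3.1)–(3.2)] -/
def pintz1976Deuring_lemma4 : Prop :=
  ∃ C : ℝ, ∀ (D : ℕ) [NeZero D] (χ : DirichletCharacter ℂ D), χ ≠ 1 →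
    ∀ s : ℂ, s ≠ 1 → 0 ≤ 1 - s.re → 1 - s.re ≤ 1 / 2 →
      ∀ x : ℝ, ‖s‖ ^ 2 * max 1 (1 / ‖1 - s‖) * Real.sqrt D ≤ x →
        ‖(∑ n ∈ Icc 1 ⌊x⌋₊, (∑ d ∈ n.divisors, χ (d : ZMod D)) * (n : ℂ) ^ (-s)) -
            χ.LFunction s * riemannZeta s - χ.LFunction 1 * (x : ℂ) ^ (1 - s) / (1 - s)‖ ≤
          C * (x ^ (1 - s.re) * ‖s‖ * (D : ℝ) ^ (1 / 4 : ℝ) * Real.sqrt (max 1 (1 / ‖1 - s‖)) *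
            Real.log D * Real.log x / Real.sqrt x)

/-- **Pintz 1976 (III), Lemma 4 (NAMED FACT, as printed, p. 298 (3.1)–(3.2), under the paper's
standing assumption p. 296 "We shall assume that `D > D₁`, where `D₁` is an absolute effective
constant") — the REPAIRED form of `pintz1976Deuring_lemma4`.** "Let `χ` be any real or complex
non-principal character modulo `D`, `L(s) = L(s, χ)`. Then with the notations `g(n) = Σ_{d∣n} χ(d)`,
`1 ≠ s = 1 − τ + it`, `A_s = max(1, 1/|1 − s|)` for `0 ≤ τ ≤ ½` and for an arbitrary real
`x ≥ |s|²A_s√D` the relation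
`Σ_{n≤x} g(n)/n^s = L(s)ζ(s) + L(1)x^{1−s}/(1 − s) + O(x^τ|s| D^{1/4} √A_s log D log x/√x)` holds"
(p. 299: "the constant in `O` symbol is absolute"). One absolute `C`, one absolute `D₁`; for
`D > D₁` the admissible `x ≥ |s|²A_s√D ≥ √D/2` are large, so `log x ≥ 1`. Unproved here (printed
proof pp. 298–300: hyperbola split at `z = √x D^{1/4}√A_s`, `Σ_{m≤M} m^{−s} = ζ(s) + M^{1−s}/(1−s) +
O(|s|M^{τ−1})`, Pólya–Vinogradov and partial summation (3.5)–(3.7), `|ζ(s)| ≪ |s|^τ log(|s|+1)A_s`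
(3.9)). [cite: Pintz1976ElementaryIII, Lemma 4 p. 298 (3.1)–(3.2); standing assumption p. 296] -/
def pintz1976Deuring_lemma4_largeD : Prop :=
  ∃ C : ℝ, ∃ D₁ : ℕ, ∀ (D : ℕ) [NeZero D], D₁ < D → ∀ (χ : DirichletCharacter ℂ D), χ ≠ 1 →
    ∀ s : ℂ, s ≠ 1 → 0 ≤ 1 - s.re → 1 - s.re ≤ 1 / 2 →
      ∀ x : ℝ, ‖s‖ ^ 2 * max 1 (1 / ‖1 - s‖) * Real.sqrt D ≤ x →
        ‖(∑ n ∈ Icc 1 ⌊x⌋₊, (∑ d ∈ n.divisors, χ (d : ZMod D)) * (n : ℂ) ^ (-s)) -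
            χ.LFunction s * riemannZeta s - χ.LFunction 1 * (x : ℂ) ^ (1 - s) / (1 - s)‖ ≤
          C * (x ^ (1 - s.re) * ‖s‖ * (D : ℝ) ^ (1 / 4 : ℝ) * Real.sqrt (max 1 (1 / ‖1 - s‖)) *
            Real.log D * Real.log x / Real.sqrt x)

/-! ### PROVED reading -/

namespace Pintz1976Deuring

/-- The quadratic character mod `3` with values in `ℂ` (the witness modulus of
`pintz1976Deuring_lemma4_false`). [folklore] -/
private def chi3 : DirichletCharacter ℂ 3 := (quadraticChar (ZMod 3)).ringHomComp (Int.castRingHom ℂ)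

/-- `χ₃(2) = −1`. [folklore] -/
private theorem chi3_two : chi3 2 = -1 := by
  have h : quadraticChar (ZMod 3) 2 = -1 := by decide
  simp [chi3, MulChar.ringHomComp_apply, h]

/-- `χ₃` is non-principal. [folklore] -/
private theorem chi3_ne_one : chi3 ≠ 1 := by
  intro h
  have h2 : chi3 2 = 1 := by
    rw [h]
    exact MulChar.one_apply (⟨⟨2, 2, by decide, by decide⟩, rfl⟩ : IsUnit (2 : ZMod 3))
  rw [chi3_two] at h2
  norm_num at h2

end Pintz1976Deuring

open Pintz1976Deuring in
/-- **The typed `pintz1976Deuring_lemma4` is false as written** [refuted-misstated]. The typing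
dropped the paper's standing assumption "`D > D₁`, where `D₁` is an absolute effective constant"
(p. 296), under which `x ≥ |s|²A_s√D ≥ √D/2` is large; without it the modulus `D = 3` (`χ = χ₃`,
`s = 1/2`, so `|s|²A_s√D = √3/2 < 1`) admits `x = 9/10`, where `log x < 0` makes the right-hand
side negative for `C > 0`, while for `C ≤ 0` the points `x = 2, 5/2` (same integer part) force
`L(1, χ₃)·(2^{1/2} − (5/2)^{1/2}) = 0`, contradicting `L(1, χ₃) ≠ 0` (Mathlib
`DirichletCharacter.LFunction_apply_one_ne_zero`). The witness misses the repaired statement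
`pintz1976Deuring_lemma4_largeD` (`∃ C D₁, ∀ D > D₁, …`).
[cite: Pintz1976ElementaryIII, Lemma 4 p. 298; standing assumption "D > D₁" p. 296] -/
theorem pintz1976Deuring_lemma4_false : ¬ pintz1976Deuring_lemma4 := by
  rintro ⟨C, hC⟩
  set s : ℂ := ((1 / 2 : ℝ) : ℂ) with hs_def
  have hs_re : s.re = 1 / 2 := by simp [hs_def]
  have hs1 : s ≠ 1 := by
    intro h
    have := congrArg Complex.re h
    rw [hs_re, one_re] at this
    norm_num at this
  have h1s : 1 - s = ((1 / 2 : ℝ) : ℂ) := by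
    rw [hs_def]; push_cast; ring
  have hnorm_s : ‖s‖ = 1 / 2 := by
    rw [hs_def, Complex.norm_real, Real.norm_eq_abs, abs_of_pos (by norm_num)]
  have hnorm_1s : ‖1 - s‖ = 1 / 2 := by
    rw [h1s, Complex.norm_real, Real.norm_eq_abs, abs_of_pos (by norm_num)]
  have hmax : max 1 (1 / ‖1 - s‖) = 2 := by
    rw [hnorm_1s]; norm_num
  have hsqrt3 : Real.sqrt 3 ≤ 9 / 5 := by
    have h : Real.sqrt 3 ≤ Real.sqrt ((9 / 5) ^ 2) := Real.sqrt_le_sqrt (by norm_num)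
    rwa [Real.sqrt_sq (by norm_num)] at h
  have hhyp : ‖s‖ ^ 2 * max 1 (1 / ‖1 - s‖) * Real.sqrt ((3 : ℕ) : ℝ) ≤ 9 / 10 := by
    rw [hnorm_s, hmax, Nat.cast_ofNat]
    nlinarith [hsqrt3]
  have key : ∀ x : ℝ, 9 / 10 ≤ x →
      ‖(∑ n ∈ Icc 1 ⌊x⌋₊, (∑ d ∈ n.divisors, chi3 (d : ZMod 3)) * (n : ℂ) ^ (-s)) -
          chi3.LFunction s * riemannZeta s - chi3.LFunction 1 * (x : ℂ) ^ (1 - s) / (1 - s)‖ ≤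
        C * (x ^ (1 - s.re) * ‖s‖ * ((3 : ℕ) : ℝ) ^ (1 / 4 : ℝ) *
          Real.sqrt (max 1 (1 / ‖1 - s‖)) * Real.log ((3 : ℕ) : ℝ) * Real.log x / Real.sqrt x) :=
    fun x hx => hC 3 chi3 chi3_ne_one s hs1 (by rw [hs_re]; norm_num) (by rw [hs_re]; norm_num) x
      (hhyp.trans hx)
  -- the positive factor of the right-hand side
  have hP : ∀ x : ℝ, 0 < x →
      0 < x ^ (1 - s.re) * ‖s‖ * ((3 : ℕ) : ℝ) ^ (1 / 4 : ℝ) * Real.sqrt (max 1 (1 / ‖1 - s‖)) *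
        Real.log ((3 : ℕ) : ℝ) := by
    intro x hx
    rw [hnorm_s, hmax, Nat.cast_ofNat]
    have h1 : 0 < x ^ (1 - s.re) := Real.rpow_pos_of_pos hx _
    have h2 : 0 < (3 : ℝ) ^ (1 / 4 : ℝ) := Real.rpow_pos_of_pos (by norm_num) _
    have h3 : 0 < Real.sqrt 2 := Real.sqrt_pos.mpr (by norm_num)
    have h4 : 0 < Real.log 3 := Real.log_pos (by norm_num)
    positivity
  rcases le_or_gt C 0 with hC0 | hC0
  · -- `C ≤ 0`: the right-hand side is `≤ 0` at `x = 2` and at `x = 5/2`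
    have hR : ∀ x : ℝ, 1 ≤ x →
        C * (x ^ (1 - s.re) * ‖s‖ * ((3 : ℕ) : ℝ) ^ (1 / 4 : ℝ) *
          Real.sqrt (max 1 (1 / ‖1 - s‖)) * Real.log ((3 : ℕ) : ℝ) * Real.log x / Real.sqrt x) ≤
          0 := by
      intro x hx
      exact mul_nonpos_of_nonpos_of_nonneg hC0 (div_nonneg (mul_nonneg (hP x (by linarith)).le
        (Real.log_nonneg hx)) (Real.sqrt_nonneg _))
    have hA := norm_le_zero_iff.mp ((key 2 (by norm_num)).trans (hR 2 (by norm_num)))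
    have hB := norm_le_zero_iff.mp ((key (5 / 2) (by norm_num)).trans (hR (5 / 2) (by norm_num)))
    have hf2 : ⌊(2 : ℝ)⌋₊ = 2 := by simp
    have hf52 : ⌊(5 / 2 : ℝ)⌋₊ = 2 := by
      rw [Nat.floor_eq_iff (by norm_num)]; norm_num
    rw [hf2] at hA
    rw [hf52] at hB
    have hL1 : chi3.LFunction 1 ≠ 0 := DirichletCharacter.LFunction_apply_one_ne_zero chi3_ne_one
    have h1s0 : (1 - s) ≠ 0 := by rw [h1s]; norm_num
    have hpow : ((2 : ℝ) : ℂ) ^ (1 - s) = (((5 / 2 : ℝ)) : ℂ) ^ (1 - s) := by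
      have h := sub_eq_zero.mp (by linear_combination hA - hB :
        chi3.LFunction 1 * (((5 / 2 : ℝ)) : ℂ) ^ (1 - s) / (1 - s) -
          chi3.LFunction 1 * ((2 : ℝ) : ℂ) ^ (1 - s) / (1 - s) = 0)
      rw [div_eq_div_iff h1s0 h1s0, mul_comm (chi3.LFunction 1 * _) (1 - s),
        mul_comm (chi3.LFunction 1 * _) (1 - s)] at h
      have := mul_left_cancel₀ h1s0 h
      exact (mul_left_cancel₀ hL1 this).symm
    have hn := congrArg norm hpow
    rw [norm_cpow_eq_rpow_re_of_pos (by norm_num : (0 : ℝ) < 2),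
      norm_cpow_eq_rpow_re_of_pos (by norm_num : (0 : ℝ) < 5 / 2), sub_re, one_re, hs_re] at hn
    have hlt : (2 : ℝ) ^ (1 - 1 / 2 : ℝ) < (5 / 2 : ℝ) ^ (1 - 1 / 2 : ℝ) :=
      Real.rpow_lt_rpow (by norm_num) (by norm_num) (by norm_num)
    exact hlt.ne hn
  · -- `C > 0`: the right-hand side is `< 0` at `x = 9/10`
    have e := key (9 / 10) le_rfl
    have hlog : Real.log (9 / 10 : ℝ) < 0 := Real.log_neg (by norm_num) (by norm_num)
    have hneg : C * ((9 / 10 : ℝ) ^ (1 - s.re) * ‖s‖ * ((3 : ℕ) : ℝ) ^ (1 / 4 : ℝ) *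
        Real.sqrt (max 1 (1 / ‖1 - s‖)) * Real.log ((3 : ℕ) : ℝ) * Real.log (9 / 10 : ℝ) /
          Real.sqrt (9 / 10 : ℝ)) < 0 :=
      mul_neg_of_pos_of_neg hC0 (div_neg_of_neg_of_pos (mul_neg_of_pos_of_neg (hP _ (by norm_num))
        hlog) (Real.sqrt_pos.mpr (by norm_num)))
    exact absurd (e.trans_lt hneg) (not_lt.mpr (norm_nonneg _))

namespace Pintz1976Deuring

/-- **Theorem 2's `ζ`-clause isolated**: for `0 < ε < 1/8` there is `D₁(ε)` such that an imaginary
quadratic field with `|d_K| > D₁(ε)` and `h_K ≤ (log|d_K|)^{3/4}` makes `ζ(s) ≠ 0` throughout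
`H(ε, |d_K|)` (Deuring 1933 in Pintz's quantitative form; the odd primitive quadratic character
mod `|d_K|` — the Kronecker character of `K` — is taken as a datum).
[cite: Pintz1976ElementaryIII, Theorem 2] -/
theorem riemannZeta_ne_zero_of_theorem2 (h : pintz1976Deuring_theorem2) {ε : ℝ} (hε : 0 < ε)
    (hε' : ε < 1 / 8) :
    ∃ D₁ : ℕ, ∀ (K : Type) [Field K] [NumberField K] [NeZero (NumberField.discr K).natAbs],
      Module.finrank ℚ K = 2 → NumberField.discr K < 0 → D₁ < (NumberField.discr K).natAbs →
      (NumberField.classNumber K : ℝ) ≤ Real.log (NumberField.discr K).natAbs ^ (3 / 4 : ℝ) →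
      (∃ χ : DirichletCharacter ℂ (NumberField.discr K).natAbs,
        χ.IsQuadratic ∧ χ.IsPrimitive ∧ χ.Odd) →
      ∀ s : ℂ, s ∈ Pintz1976Deuring.region ε (NumberField.discr K).natAbs → riemannZeta s ≠ 0 := by
  obtain ⟨C, D₁, hD₁⟩ := h ε hε hε'
  refine ⟨D₁, fun K _ _ _ h2 hneg hD hcl ⟨χ, hquad, hprim, hodd⟩ s hs => ?_⟩
  exact (hD₁ K h2 hneg hD hcl χ hquad hprim hodd s hs).2.1

end Pintz1976Deuring

end Literature.NumberTheory.LFunctions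

end
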